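import Summits.ABC.StewartYu.PadicG3OddLines
import Summits.ABC.StewartYu.PadicG3OneSizes
import Literature.NumberTheory.Transcendental.PiTranscendenceMeasureMain
import HarnessLib

/-!
# Cell abc-stewartyu, crux `Y07Odd` (stmt-ABC-19658), line `gen3-slab-odd`, branch `m ≥ 1`: the HALF-STEP GAIN LINE at the v1 schedule
# `P.sched1b b` — the `hgainH` slot of `G3Setup.ineqs1_of_gainLines` (`PadicG3OneAssembly`)

`Summits/ABC/StewartYu/PadicG3OneHalfLine.lean` — cell `abc-stewartyu` (HOME `run/shared/lean/pub/abc-stewartyu/`), seat p5 (g4); route-holder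
assignment 2026-08-27T06:36:41Z.  Theorems only; no named fact.  With `Z := G·X·L`, at `Sc := P.sched1b b` (`b ≥ 1`, heights `h(αⱼ) ≤ Aⱼ`,
`Aⱼ ≥ 1`, `log max(3,|bⱼ|) ≤ W`, `θ₀ = ½`), for every level `lev < Ŝ`, odd `|s₁| ≤ 2·NhS(lev+1) − 1` and order `τ` with `|τ| + tS lev ≤ TordS lev n`:

  `log BwP + 2^{n+1}·(log 4 + 2·log DCs + log(1 + U·P·MhCs) + 3·log ∏H(α)) − log DCs < (2·NS lev n + 1)·tS lev·(m+½)·log p`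

(**`hgainH_sched1b`**).  Slots (all in the tree): `log BwP ≤ Z/4 + G + 1`; the sharp half-point clearing (S1) `2·log halfDen + log halfHgtR ≤
2·(2|s₁|·Σ Lbⱼ h(αⱼ)) ≤ Z` (`two_mul_log_halfDen_add_le`, p1's `halfHeight_1b_le`); the shared order budget `τ.1 + |τ.2| ≤ (43/5)(n+1)L`
charged at the `τ.1`-rate `(69/20)H + W_L + log 2` (since the `|τ.2|`-rate `2W + log max(1,XbC) ≤ (63/20)H` is smaller; sharp
`ψ(H) ≤ (23/20)H`, `NWPi.log_lcmUpto_le`) `≤ (5/8)·Z`; `log UcardS₂ ≤ lunk ≤ Z/32 + 1` (p1's `log_UcardS₂_1b_le`); `log PmaxS₂ ≤ (141/100)·Z + yload + 3`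
(`log_PmaxS₂_1b_le`, on p1's `log_AmaxS₂_1b_le`); the `Y₀`-line `≤ Z/4 + yload`; `3·log ∏H(α) ≤ Z/32`; gain `≥ (31/4)·2ⁿ·Z` (`Xs·(T+1) ≥ (31/8)·X·L`).  Numerics of the
bound chain: per-degree cost ≤ 3.37·Z + 2·yload vs budget (31/8)·Z (HOME/p5/census-halfstep/provable_hH.py; exact census margin 1.51).

References: Yu. V. Nesterenko, LNM 1819 (2003) §4.3 (4.39)–(4.45); K. Yu, Compositio 74 (1990) Lemma 2.5; Nesterenko–Waldschmidt 1996 §4 (4.2).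
-/

noncomputable section

open NormedSpace Finset Polynomial
open Literature.NumberTheory.Transcendental
open Literature.NumberTheory.Transcendental.PadicCW77 (condExp)
open Literature.NumberTheory.Transcendental.CW77.Setup (Tau tauNorm)
open scoped Nat

namespace Summit.ABC.StewartYu

namespace G3Setup

variable {p : ℕ} [Fact p.Prime] (S : G3Setup p) (P : PadicG3Par S.n) (b : ℝ)

/-! ### Atoms -/

/-- `log ν(H) ≤ (23/20)·H` at the record's `H` (sharp prime-number bound). [cite: Nesterenko2003, (3.8); shape only] -/
theorem log_lcm_H_le : Real.log (Nat.lcmUpto P.H : ℝ) ≤ (23 / 20) * (P.H : ℝ) := NWPi.log_lcmUpto_le P.H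

/-- `H ≤ Z/64` (`(n+1)·L·H ≤ Z/64`, `(n+1)L ≥ 1`). [folklore] -/
theorem H_le_Z : (P.H : ℝ) ≤ P.G * P.X * P.L / 64 := by
  have h := P.succ_mul_L_mul_H_le_Z
  have hL := P.one_le_L
  have hH : (0 : ℝ) ≤ P.H := Nat.cast_nonneg _
  have hn : (0 : ℝ) ≤ (S.n : ℝ) := Nat.cast_nonneg _
  have hnL : (1 : ℝ) ≤ ((S.n : ℝ) + 1) * P.L := by nlinarith
  have h1 : 1 * (P.H : ℝ) ≤ ((S.n : ℝ) + 1) * P.L * P.H := mul_le_mul_of_nonneg_right hnL hH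
  linarith

/-- `1 ≤ UcardS₂` (local copy; public: p3-g7's `PadicG3VbSizes.one_le_UcardS₂`). [folklore] -/
private theorem one_le_U (Sc : G3Sched S.n) : 1 ≤ S.UcardS₂ Sc := by
  unfold UcardS₂
  exact one_le_mul (by omega) (Finset.one_le_prod' fun j _ => by omega)

/-- `log BwP ≤ Z/4 + G + 1` (local copy; public: p1-g8's `PadicG3OneLines.log_BwP_1b_le`). [cite: Nesterenko2003, (3.8); shape only] -/
private theorem log_BwP_1b_le' (hPp : P.p = p) (hθ : P.θ₀ = 1 / 2) :
    Real.log (BwP (p := p) P.L₀ P.m) ≤ P.G * P.X * P.L / 4 + P.G + 1 := by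
  have hp : p.Prime := Fact.out
  have hp2 : (2 : ℝ) ≤ p := by exact_mod_cast hp.two_le
  have hlogp : 0 < Real.log p := Real.log_pos (by linarith)
  rw [G3OddLog.log_BwP]
  have hG : ((P.m : ℝ) + 1 / 2) * Real.log p = P.G := by
    have h := P.half_log_eq_G hθ
    rw [hPp] at h
    exact h
  rw [hG]
  have h1 : (((P.L₀ / (p - 1) : ℕ) : ℝ)) * Real.log p ≤ P.L₀ := by
    have hdiv : (((P.L₀ / (p - 1) : ℕ) : ℝ)) ≤ (P.L₀ : ℝ) / ((p : ℝ) - 1) := by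
      have := Nat.cast_div_le (m := P.L₀) (n := p - 1) (α := ℝ)
      have hsub : ((p - 1 : ℕ) : ℝ) = (p : ℝ) - 1 := by
        rw [Nat.cast_sub hp.one_lt.le]; push_cast; ring
      rw [hsub] at this; exact this
    have hlp : Real.log p ≤ (p : ℝ) - 1 := by
      have := Real.log_le_sub_one_of_pos (show (0:ℝ) < p by linarith); linarith
    have hp1 : (0 : ℝ) < (p : ℝ) - 1 := by linarith
    calc (((P.L₀ / (p - 1) : ℕ) : ℝ)) * Real.log p ≤ ((P.L₀ : ℝ) / ((p : ℝ) - 1)) * ((p : ℝ) - 1) :=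
          mul_le_mul hdiv hlp hlogp.le (by positivity)
      _ = P.L₀ := div_mul_cancel₀ _ hp1.ne'
  have h2 := P.L0_mul_G_add_one_le
  nlinarith

/-- `log UcardS₂ ≤ lunk` (local copy; public: p1-g8's `PadicG3OneLines.log_UcardS₂_1b_le`). [folklore] -/
private theorem log_UcardS₂_1b_le' (hb : 1 ≤ b) (hA1 : ∀ j, 1 ≤ P.A j) : Real.log (S.UcardS₂ (P.sched1b b) : ℝ) ≤ P.lunk := by
  rw [S.log_UcardS₂_eq]
  unfold PadicG3Par.lunk
  have hL := P.one_le_L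
  have hb0 : 0 < b := lt_of_lt_of_le zero_lt_one hb
  have hside : ∀ j, 2 * (S.sideS₂ (P.sched1b b) j : ℝ) + 1 ≤ 2 * P.L := by
    intro j
    have h := S.two_sideS₂_add_one_le (P.sched1b b) (by rw [P.sched1b_Lbox]; positivity) j
    rw [P.sched1b_Lbox, P.sched1b_A] at h
    have hA := hA1 j
    have h2 : (P.L : ℝ) / b / P.A j ≤ P.L := by
      rw [div_div]
      exact div_le_self (by positivity) (by nlinarith)
    linarith
  have hsum : ∑ j, Real.log (2 * (S.sideS₂ (P.sched1b b) j : ℝ) + 1) ≤ ∑ _j : Fin S.n, Real.log (2 * (P.L : ℝ)) :=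
    Finset.sum_le_sum fun j _ => Real.log_le_log (by positivity) (hside j)
  rw [Finset.sum_const, Finset.card_univ, Fintype.card_fin, nsmul_eq_mul] at hsum
  have hL₀ : Real.log (((P.sched1b b).L₀ : ℝ) + 1) = Real.log ((P.L₀ : ℝ) + 1) := by rw [P.sched1b_L₀]
  rw [hL₀]
  linarith

/-- `log XbSS₂ ≤ (23/20)·H` at `sched1b b`. [folklore] -/
private theorem log_XbSS₂_1b_le' (hb : 1 ≤ b) (hA1 : ∀ j, 1 ≤ P.A j) (hWb : ∀ j, Real.log (max 3 (|S.b j| : ℝ)) ≤ P.W) :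
    Real.log (S.XbSS₂ (P.sched1b b) : ℝ) ≤ (23 / 20) * P.H := by
  rw [S.XbSS₂_cast]; exact S.log_XbC_1b_le_H P b hWb hA1 hb 0

/-- The START Hasse size `log M0C(L₀,H,Ŝ,0,X₀,T₀) ≤ log 2 + T₀·(W_L + (23/20)H) + H + (Z/4 + yload)`. [folklore] -/
private theorem log_M0C_start_1b_le' :
    Real.log (M0C P.L₀ P.H P.Sdepth 0 (S.NS (P.sched1b b) 0 0 : ℤ) (S.TordS (P.sched1b b) 0 0) : ℝ) ≤
      Real.log 2 + (S.TordS (P.sched1b b) 0 0 : ℝ) * (P.WL + (23 / 20) * P.H) + P.H + (P.G * P.X * P.L / 4 + P.yload) := by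
  have h := log_M0C_le' P.L₀ P.H P.Sdepth 0 (S.NS (P.sched1b b) 0 0 : ℤ) (S.TordS (P.sched1b b) 0 0)
  have hL0 := S.L0_line_start_1b_le P b
  have hSd := P.Sdepth_log_two_le_WL
  have hν := S.log_lcm_H_le P
  have hT0 : (0 : ℝ) ≤ (S.TordS (P.sched1b b) 0 0 : ℝ) := Nat.cast_nonneg _
  have hHe : (P.H : ℝ) / Real.exp 1 ≤ P.H := div_le_self (Nat.cast_nonneg _) (by have := Real.add_one_le_exp (1:ℝ); linarith)
  have h1 : (((P.Sdepth - 0) * S.TordS (P.sched1b b) 0 0 : ℕ) : ℝ) * Real.log 2 ≤ (S.TordS (P.sched1b b) 0 0 : ℝ) * P.WL := by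
    push_cast
    simp only [tsub_zero]
    have := mul_le_mul_of_nonneg_left hSd hT0
    nlinarith
  have h2 : (S.TordS (P.sched1b b) 0 0 : ℝ) * Real.log (Nat.lcmUpto P.H : ℝ) ≤ (S.TordS (P.sched1b b) 0 0 : ℝ) * ((23 / 20) * P.H) :=
    mul_le_mul_of_nonneg_left hν hT0
  nlinarith

/-- `log AmaxS₂ ≤ (11/8)·Z + yload + 1` at `sched1b b` (local; p1-g8's public `log_AmaxS₂_1b_le` has `(34/25)Z + yload + H + 1`). [folklore] -/
private theorem log_AmaxS₂_1b_le' (hb : 1 ≤ b) (hA1 : ∀ j, 1 ≤ P.A j) (hV : ∀ j, Height.logHeight₁ (S.α j) ≤ P.A j)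
    (hWb : ∀ j, Real.log (max 3 (|S.b j| : ℝ)) ≤ P.W) :
    Real.log (S.AmaxS₂ (P.sched1b b)) ≤ (11 / 8) * (P.G * P.X * P.L) + P.yload + 1 := by
  rw [S.log_AmaxS₂_eq]
  have hM := S.log_M0C_start_1b_le' P b
  have hX := S.log_XbSS₂_1b_le' P b hb hA1 hWb
  have hmon := S.two_log_monDen_start_1b_le P b hV hb
  have hT0 := S.TordS_1b_zero_real_le P b
  have hT00 : (0 : ℝ) ≤ (S.TordS (P.sched1b b) 0 0 : ℝ) := Nat.cast_nonneg _
  have hWL := P.WL_mul_le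
  have hLH := P.succ_mul_L_mul_H_le_Z
  have hHZ := S.H_le_Z P
  have hH0 : (0 : ℝ) ≤ P.H := Nat.cast_nonneg _
  have hWL1 := P.WL_ge_one
  have hl2 : Real.log 2 ≤ 7 / 10 := by have := Real.log_two_lt_d9; linarith
  have e1 : (P.sched1b b).L₀ = P.L₀ := rfl
  have e2 : (P.sched1b b).H = P.H := rfl
  have e3 : (P.sched1b b).Sd = P.Sdepth := rfl
  rw [e1, e2, e3]
  have h1 : (S.TordS (P.sched1b b) 0 0 : ℕ) * Real.log (S.XbSS₂ (P.sched1b b) : ℝ) ≤ (83 / 5) * (S.n + 1) * P.L * ((23 / 20) * P.H) := by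
    have hx0 : 0 ≤ Real.log (S.XbSS₂ (P.sched1b b) : ℝ) := Real.log_nonneg (by rw [S.XbSS₂_cast]; exact le_max_left _ _)
    calc (S.TordS (P.sched1b b) 0 0 : ℕ) * Real.log (S.XbSS₂ (P.sched1b b) : ℝ) ≤ (S.TordS (P.sched1b b) 0 0 : ℝ) * ((23 / 20) * P.H) :=
          mul_le_mul_of_nonneg_left hX hT00
      _ ≤ (83 / 5) * (S.n + 1) * P.L * ((23 / 20) * P.H) := mul_le_mul_of_nonneg_right hT0 (by positivity)
  have h2 : (S.TordS (P.sched1b b) 0 0 : ℝ) * (P.WL + (23 / 20) * P.H) ≤ (83 / 5) * (S.n + 1) * P.L * (P.WL + (23 / 20) * P.H) :=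
    mul_le_mul_of_nonneg_right hT0 (by positivity)
  nlinarith

/-- **`log PmaxS₂ ≤ (141/100)·Z + yload + 3`** at `sched1b b`. [folklore] -/
theorem log_PmaxS₂_1b_le (hb : 1 ≤ b) (hA1 : ∀ j, 1 ≤ P.A j) (hV : ∀ j, Height.logHeight₁ (S.α j) ≤ P.A j)
    (hWb : ∀ j, Real.log (max 3 (|S.b j| : ℝ)) ≤ P.W) :
    Real.log (S.PmaxS₂ (P.sched1b b) : ℝ) ≤ (141 / 100) * (P.G * P.X * P.L) + P.yload + 3 := by
  have h1 := S.log_PmaxS₂_le (P.sched1b b)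
  have h2 := S.log_UcardS₂_1b_le' P b hb hA1
  have h3 := S.log_AmaxS₂_1b_le' P b hb hA1 hV hWb
  have h4 := P.lunk_le
  have h5 := S.H_le_Z P
  have hl2 : Real.log 2 ≤ 7 / 10 := by have := Real.log_two_lt_d9; linarith
  have hZ0 : 0 ≤ P.G * P.X * P.L := by have := P.sixteen_le_G; positivity
  linarith

/-! ### The shared order budget of the half-step, charged at the `τ.1`-rate -/

/-- **Order cost of the half-step**: with `τ.1 + |τ.2| + tS lev ≤ TordS lev n`,
`3·τ.1·log ν(H) + τ.1·log 2 + ((Ŝ−(lev+1))·τ.1)·log 2 + 2W·|τ.2| + |τ.2|·log max(1, XbC(Lb side lev)) ≤ (5/8)·Z`. [folklore] -/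
theorem halfOrderCost_1b_le (hb : 1 ≤ b) (hA1 : ∀ j, 1 ≤ P.A j) (hWb : ∀ j, Real.log (max 3 (|S.b j| : ℝ)) ≤ P.W)
    (lev : ℕ) {τ : Tau S.n} (hτ : tauNorm τ + S.tS (P.sched1b b) lev ≤ S.TordS (P.sched1b b) lev S.n) :
    3 * ((τ.1 : ℝ) * Real.log (Nat.lcmUpto P.H : ℝ)) + (τ.1 : ℝ) * Real.log 2 +
        (((P.Sdepth - (lev + 1)) * τ.1 : ℕ) : ℝ) * Real.log 2 + 2 * (P.W * ∑ k, (τ.2 k : ℝ)) +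
        (∑ k, τ.2 k : ℕ) * Real.log (max 1 (S.XbC (S.Lb (S.sideS₂ (P.sched1b b)) lev) : ℝ)) ≤
      (5 / 8) * (P.G * P.X * P.L) := by
  -- the two rates
  have hν := S.log_lcm_H_le P
  have hSd := P.Sdepth_log_two_le_WL
  have hst := S.two_W_add_log_XbC_1b_le_H P b hWb hA1 hb lev
  have hWH := P.WL_le_H_add_one
  have hWL1 := P.WL_ge_one
  have hH0 : (0 : ℝ) ≤ P.H := Nat.cast_nonneg _
  have hl2 : Real.log 2 ≤ 7 / 10 := by have := Real.log_two_lt_d9; linarith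
  have hl20 : 0 ≤ Real.log 2 := Real.log_nonneg (by norm_num)
  have hX0 : 0 ≤ Real.log (max 1 (S.XbC (S.Lb (S.sideS₂ (P.sched1b b)) lev) : ℝ)) := Real.log_nonneg (le_max_left _ _)
  -- the budget
  have hT := S.TordS_1b_half_sub_real_le P b lev
  have hsub : tauNorm τ ≤ S.TordS (P.sched1b b) lev S.n - S.tS (P.sched1b b) lev := Nat.le_sub_of_add_le hτ
  have hsum : (τ.1 : ℝ) + ((∑ k, τ.2 k : ℕ) : ℝ) ≤ (43 / 5) * (S.n + 1) * P.L := by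
    have : ((tauNorm τ : ℕ) : ℝ) ≤ (43 / 5) * (S.n + 1) * P.L := le_trans (by exact_mod_cast hsub) hT
    unfold tauNorm at this; push_cast at this ⊢; exact this
  have ht0 : (0 : ℝ) ≤ τ.1 := Nat.cast_nonneg _
  have hs0 : (0 : ℝ) ≤ ((∑ k, τ.2 k : ℕ) : ℝ) := Nat.cast_nonneg _
  -- rates: rate₀ := (69/20)H + W_L + log 2 ≥ the |τ.2|-rate (63/20)H
  set r : ℝ := (69 / 20) * P.H + P.WL + Real.log 2 with hr
  have hr0 : 0 ≤ r := by rw [hr]; positivity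
  have hrate0 : 3 * Real.log (Nat.lcmUpto P.H : ℝ) + Real.log 2 + ((P.Sdepth - (lev + 1) : ℕ) : ℝ) * Real.log 2 ≤ r := by
    have hS : ((P.Sdepth - (lev + 1) : ℕ) : ℝ) * Real.log 2 ≤ (P.Sdepth : ℝ) * Real.log 2 :=
      mul_le_mul_of_nonneg_right (by exact_mod_cast Nat.sub_le _ _) hl20
    rw [hr]; linarith
  have hrate1 : 2 * P.W + Real.log (max 1 (S.XbC (S.Lb (S.sideS₂ (P.sched1b b)) lev) : ℝ)) ≤ r := by rw [hr]; linarith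
  -- cost ≤ τ.1·r + |τ.2|·r ≤ (43/5)(n+1)L·r
  have hc0 : 3 * ((τ.1 : ℝ) * Real.log (Nat.lcmUpto P.H : ℝ)) + (τ.1 : ℝ) * Real.log 2 +
      (((P.Sdepth - (lev + 1)) * τ.1 : ℕ) : ℝ) * Real.log 2 ≤ (τ.1 : ℝ) * r := by
    have := mul_le_mul_of_nonneg_left hrate0 ht0
    push_cast at this ⊢
    nlinarith
  have hc1 : 2 * (P.W * ∑ k, (τ.2 k : ℝ)) + (∑ k, τ.2 k : ℕ) * Real.log (max 1 (S.XbC (S.Lb (S.sideS₂ (P.sched1b b)) lev) : ℝ)) ≤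
      ((∑ k, τ.2 k : ℕ) : ℝ) * r := by
    have := mul_le_mul_of_nonneg_left hrate1 hs0
    push_cast at this ⊢
    nlinarith
  have hc2 : ((τ.1 : ℝ) + ((∑ k, τ.2 k : ℕ) : ℝ)) * r ≤ (43 / 5) * (S.n + 1) * P.L * r := mul_le_mul_of_nonneg_right hsum hr0
  -- (43/5)(n+1)L·r ≤ (5/8)Z
  have hLH := P.succ_mul_L_mul_H_le_Z
  have hWL := P.WL_mul_le
  have hL576 := P.succ_mul_L_le
  have hfin : (43 / 5) * ((S.n : ℝ) + 1) * P.L * r ≤ (5 / 8) * (P.G * P.X * P.L) := by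
    rw [hr]
    have hnL : (0 : ℝ) ≤ ((S.n : ℝ) + 1) * P.L := by have := P.one_le_L; positivity
    nlinarith [mul_le_mul_of_nonneg_left hl2 hnL]
  push_cast at hc0 hc1 hc2 hfin ⊢
  have e : ((τ.1 : ℝ) + ∑ x, (τ.2 x : ℝ)) * r = (τ.1 : ℝ) * r + (∑ x, (τ.2 x : ℝ)) * r := by ring
  linarith

/-- `log DCs ≤ τ.1·log ν(H) + W·|τ.2| + log halfDen` (the pieces of `DCs`, with `log|b_{j₀}| ≤ W`; p4's `log_DCs_split` is the equality). [folklore] -/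
theorem log_DCs_le_split {W : ℝ} (hWb : ∀ j, Real.log (max 3 (|S.b j| : ℝ)) ≤ W) (L : Fin S.n → ℕ) (H : ℕ) (s₁ : ℤ) (τ : Tau S.n) :
    Real.log (S.DCs L H s₁ τ : ℝ) ≤ τ.1 * Real.log (Nat.lcmUpto H : ℝ) + W * ∑ k, (τ.2 k : ℝ) + Real.log (S.halfDen L s₁ : ℝ) := by
  have hν : (0 : ℝ) < (Nat.lcmUpto H : ℝ) := by exact_mod_cast Nat.lcmUpto_pos H
  have hb1 : (1 : ℝ) ≤ (((S.b S.j₀).natAbs : ℕ) : ℝ) := by exact_mod_cast Int.natAbs_pos.mpr S.bj₀_ne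
  have hd1 : (1 : ℝ) ≤ (S.halfDen L s₁ : ℝ) := by exact_mod_cast S.one_le_halfDen L s₁
  unfold DCs
  push_cast
  rw [Real.log_mul (by positivity) (by positivity), Real.log_mul (by positivity) (by positivity), Real.log_pow, Real.log_pow]
  have hb : Real.log (((S.b S.j₀).natAbs : ℕ) : ℝ) ≤ W := by
    have h := S.abs_b_le_exp hWb S.j₀
    rw [Nat.cast_natAbs, Int.cast_abs]
    have h3 : (0 : ℝ) < |((S.b S.j₀ : ℤ) : ℝ)| := by
      have : (S.b S.j₀ : ℝ) ≠ 0 := by exact_mod_cast S.bj₀_ne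
      exact abs_pos.mpr this
    calc Real.log |((S.b S.j₀ : ℤ) : ℝ)| ≤ Real.log (Real.exp W) := Real.log_le_log h3 h
      _ = W := Real.log_exp W
  have hsum0 : (0 : ℝ) ≤ ∑ k, (τ.2 k : ℝ) := sum_nonneg fun k _ => by positivity
  have h2 : (∑ k, τ.2 k : ℕ) * Real.log (((S.b S.j₀).natAbs : ℕ) : ℝ) ≤ W * ∑ k, (τ.2 k : ℝ) := by
    push_cast; rw [mul_comm]; exact mul_le_mul_of_nonneg_right hb hsum0
  linarith

/-! ### The half-step gain line -/

/-- **THE HALF-STEP GAIN LINE at `sched1b b`** — the `hgainH` slot of `ineqs1_of_gainLines` / `ineqPackR₃_of_lines`: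
`log BwP + 2^{n+1}·(log 4 + 2·log DCs + log(1 + U·P·MhCs) + 3·log ∏H(α)) − log DCs < (2·NS lev n + 1)·tS lev·(m+½)·log p`
for `lev < Ŝ`, odd `|s₁| ≤ 2·NhS(lev+1) − 1`, `|τ| + tS lev ≤ TordS lev n`. [cite: Nesterenko2003, §4.3 (4.39)–(4.45); shape only] -/
theorem hgainH_sched1b (hb : 1 ≤ b) (hn2 : 2 ≤ S.n) (hPp : P.p = p) (hθ : P.θ₀ = 1 / 2) (hA1 : ∀ j, 1 ≤ P.A j)
    (hV : ∀ j, Height.logHeight₁ (S.α j) ≤ P.A j) (hWb : ∀ j, Real.log (max 3 (|S.b j| : ℝ)) ≤ P.W) :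
    ∀ lev < (P.sched1b b).Sd, ∀ s₁ : ℤ, Odd s₁ → |s₁| ≤ (2 * S.NhS (P.sched1b b) (lev + 1) - 1 : ℤ) →
      ∀ τ : Tau S.n, tauNorm τ + S.tS (P.sched1b b) lev ≤ S.TordS (P.sched1b b) lev S.n →
      Real.log (BwP (p := p) (P.sched1b b).L₀ (P.sched1b b).m) +
          (((2 ^ (S.n + 1) : ℕ) : ℝ)) * (Real.log 4 + 2 * Real.log (S.DCs (S.Lb (S.sideS₂ (P.sched1b b)) lev) (P.sched1b b).H s₁ τ : ℝ) +
            Real.log (1 + (S.UcardS₂ (P.sched1b b) : ℝ) * (S.PmaxS₂ (P.sched1b b)) *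
              S.MhCs (S.Lb (S.sideS₂ (P.sched1b b)) lev) (P.sched1b b).L₀ (P.sched1b b).H (P.sched1b b).Sd lev s₁ τ) +
            3 * Real.log (CW77.heightProd S.α)) -
          Real.log (S.DCs (S.Lb (S.sideS₂ (P.sched1b b)) lev) (P.sched1b b).H s₁ τ : ℝ) <
        (((2 * S.NS (P.sched1b b) lev S.n + 1) * S.tS (P.sched1b b) lev : ℕ) : ℝ) * ((((P.sched1b b).m : ℝ) + 1 / 2) * Real.log p) := by
  intro lev hlev s₁ _hs₁ hs₁ τ hτ
  have hp : p.Prime := Fact.out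
  -- the schedule's fields are `P`'s
  have eL₀ : (P.sched1b b).L₀ = P.L₀ := rfl
  have eH : (P.sched1b b).H = P.H := rfl
  have eSd : (P.sched1b b).Sd = P.Sdepth := rfl
  have em : (P.sched1b b).m = P.m := rfl
  rw [eL₀, eH, eSd, em]
  rw [eSd] at hlev
  set L : Fin S.n → ℕ := S.Lb (S.sideS₂ (P.sched1b b)) lev with hLdef
  set Z : ℝ := P.G * P.X * P.L with hZ
  -- positivity
  have hG16 := P.sixteen_le_G
  have hG0 : (0 : ℝ) ≤ P.G := by linarith
  have hZbig : (16 : ℝ) * 72 * 2 ^ 25 ≤ Z := by rw [hZ]; exact P.GXL_ge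
  have hZ0 : 0 ≤ Z := le_trans (by positivity) hZbig
  have hl2 : Real.log 2 ≤ 7 / 10 := by have := Real.log_two_lt_d9; linarith
  have hl4 : Real.log 4 ≤ 7 / 5 := by
    rw [show (4 : ℝ) = 2 ^ 2 by norm_num, Real.log_pow]; push_cast; linarith
  -- (1) the weight
  have hBw : Real.log (BwP (p := p) P.L₀ P.m) ≤ Z / 4 + P.G + 1 := by rw [hZ]; exact S.log_BwP_1b_le' P hPp hθ
  -- (2) the clearing denominator
  have hD := S.log_DCs_le_split hWb L P.H s₁ τ
  have hD0 : 0 ≤ Real.log (S.DCs L P.H s₁ τ : ℝ) := Real.log_nonneg (by exact_mod_cast S.one_le_DCs L P.H s₁ τ)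
  -- (3) the class-sum size
  have hMh := S.log_one_add_UPMhCs_le (S.one_le_U (P.sched1b b)) (S.one_le_PmaxS₂ (P.sched1b b)) L P.L₀ P.H P.Sdepth lev s₁ τ
  have hM0 := log_M0C_le' P.L₀ P.H P.Sdepth (lev + 1) s₁ τ.1
  have hL0l : (P.L₀ : ℝ) * (1 + Real.log (1 + |((2 ^ (P.Sdepth - (lev + 1)) * s₁ : ℤ) : ℝ)| / P.H)) ≤ Z / 4 + P.yload := by
    rw [hZ]; exact S.L0_line_H_1b_le P b (by omega) hs₁
  have hHe : (P.H : ℝ) / Real.exp 1 ≤ Z / 64 := by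
    have h1 : (P.H : ℝ) / Real.exp 1 ≤ P.H := div_le_self (Nat.cast_nonneg _) (by have := Real.add_one_le_exp (1:ℝ); linarith)
    have h2 : (P.H : ℝ) ≤ Z / 64 := by rw [hZ]; exact S.H_le_Z P
    linarith
  -- (4) the height (S1): `2·log halfDen + log halfHgtR ≤ Z`
  have hh1 := S.two_mul_log_halfDen_add_le L s₁
  have hh2 := S.sum_halfE_mul_eq L s₁
  have hh3 : 2 * |(s₁ : ℝ)| * ∑ j, (L j : ℝ) * Height.logHeight₁ (S.α j) ≤ Z / 2 := by
    rw [hZ, hLdef]; exact S.halfHeight_1b_le P b hV hb lev hs₁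
  -- (5) the shared order budget at the `τ.1`-rate
  have hord : 3 * ((τ.1 : ℝ) * Real.log (Nat.lcmUpto P.H : ℝ)) + (τ.1 : ℝ) * Real.log 2 +
      (((P.Sdepth - (lev + 1)) * τ.1 : ℕ) : ℝ) * Real.log 2 + 2 * (P.W * ∑ k, (τ.2 k : ℝ)) +
      (∑ k, τ.2 k : ℕ) * Real.log (max 1 (S.XbC L : ℝ)) ≤ (5 / 8) * Z := by
    rw [hZ, hLdef]; exact S.halfOrderCost_1b_le P b hb hA1 hWb lev hτ
  -- (6) unknowns and Siegel size
  have hU := S.log_UcardS₂_1b_le' P b hb hA1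
  have hlunk : P.lunk ≤ Z / 32 + 1 := by rw [hZ]; exact P.lunk_le
  have hPm : Real.log (S.PmaxS₂ (P.sched1b b) : ℝ) ≤ (141 / 100) * Z + P.yload + 3 := by rw [hZ]; exact S.log_PmaxS₂_1b_le P b hb hA1 hV hWb
  -- (7) the naive heights
  have hP3 : 3 * Real.log (CW77.heightProd S.α) ≤ Z / 32 := by rw [hZ]; exact S.three_log_heightProd_le_Z P hV
  -- the per-degree cost
  have hDR : Real.log 4 + 2 * Real.log (S.DCs L P.H s₁ τ : ℝ) +
      Real.log (1 + (S.UcardS₂ (P.sched1b b) : ℝ) * (S.PmaxS₂ (P.sched1b b)) * S.MhCs L P.L₀ P.H P.Sdepth lev s₁ τ) +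
      3 * Real.log (CW77.heightProd S.α) ≤ (27 / 8) * Z + 2 * P.yload + 7 := by
    rw [hh2] at hh1
    push_cast at hM0 hord hMh hL0l hD ⊢
    linarith
  -- (8) the gain
  have hGeq : ((P.m : ℝ) + 1 / 2) * Real.log p = P.G := by
    have h := P.half_log_eq_G hθ
    rw [hPp] at h
    exact h
  have hgain : (31 / 4) * 2 ^ S.n * Z ≤
      (((2 * S.NS (P.sched1b b) lev S.n + 1) * S.tS (P.sched1b b) lev : ℕ) : ℝ) * (((P.m : ℝ) + 1 / 2) * Real.log p) := by
    rw [hGeq, S.NS_1b P b, S.tS_1b P b]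
    push_cast
    have h1 := P.Xs_mul_ge' lev
    have ht : (0 : ℝ) ≤ (P.T lev : ℝ) + 1 := by positivity
    have h2 : 2 * 2 ^ S.n * ((31 / 8 : ℝ) * P.X * P.L) ≤ 2 * 2 ^ S.n * ((P.Xs lev : ℝ) * (P.T lev + 1)) :=
      mul_le_mul_of_nonneg_left h1 (by positivity)
    have h3 : 2 * 2 ^ S.n * ((P.Xs lev : ℝ) * (P.T lev + 1)) ≤ (2 * (2 ^ S.n * (P.Xs lev : ℝ)) + 1) * ((P.T lev : ℝ) + 1) := by
      have e : (2 * (2 ^ S.n * (P.Xs lev : ℝ)) + 1) * ((P.T lev : ℝ) + 1) = 2 * 2 ^ S.n * ((P.Xs lev : ℝ) * (P.T lev + 1)) + ((P.T lev : ℝ) + 1) := by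
        ring
      linarith
    have h4 := mul_le_mul_of_nonneg_right (h2.trans h3) hG0
    have e2 : 2 * 2 ^ S.n * ((31 / 8 : ℝ) * P.X * P.L) * P.G = (31 / 4) * 2 ^ S.n * Z := by rw [hZ]; ring
    linarith
  -- (9) assemble with `e := 2^{n+1} ≥ 8`
  have he : (((2 ^ (S.n + 1) : ℕ) : ℝ)) = 2 * 2 ^ S.n := by push_cast; ring
  have hsm : 2 * P.yload + P.G + 2 * P.H + 8 ≤ Z / 500 := by rw [hZ]; exact P.small_le
  have hH0 : (0 : ℝ) ≤ P.H := Nat.cast_nonneg _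
  rw [he]
  set e : ℝ := 2 * 2 ^ S.n with hedef
  have he8 : (8 : ℝ) ≤ e := by
    have h3 : (2 : ℝ) ^ 3 ≤ 2 ^ (S.n + 1) := pow_le_pow_right₀ (by norm_num) (by omega)
    have e3 : (2 : ℝ) ^ (S.n + 1) = e := by rw [hedef]; ring
    rw [e3] at h3; norm_num at h3; exact h3
  have he0 : (0 : ℝ) ≤ e := by linarith
  have hmul := mul_le_mul_of_nonneg_left hDR he0
  have x1 : e * ((27 / 8) * Z + 2 * P.yload + 7) = (27 / 8) * (e * Z) + 2 * (e * P.yload) + 7 * e := by ring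
  have hgain' : (31 / 8) * (e * Z) ≤
      (((2 * S.NS (P.sched1b b) lev S.n + 1) * S.tS (P.sched1b b) lev : ℕ) : ℝ) * (((P.m : ℝ) + 1 / 2) * Real.log p) := by
    have x3 : (31 / 4) * 2 ^ S.n * Z = (31 / 8) * (e * Z) := by rw [hedef]; ring
    rw [← x3]; exact hgain
  have hslack : 0 ≤ Z / 2 - 2 * P.yload - 7 := by linarith only [hsm, hZbig, hG0, hH0]
  have hsc := mul_le_mul_of_nonneg_right he8 hslack
  have x2 : e * (Z / 2 - 2 * P.yload - 7) = (1 / 2) * (e * Z) - 2 * (e * P.yload) - 7 * e := by ring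
  have x3 : (8 : ℝ) * (Z / 2 - 2 * P.yload - 7) = 4 * Z - 16 * P.yload - 56 := by ring
  rw [x1] at hmul
  rw [x2, x3] at hsc
  linarith only [hBw, hD0, hmul, hgain', hsc, hsm, hZbig, hG0, hH0, he8]

end G3Setup

end Summit.ABC.StewartYu

end
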